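import Literature.Probability.Percolation.ConstrainedClusters
import HarnessLib

/-!
# Alternating chains across an interface, I: the deterministic skeleton

Problem-side engine of the seat `solo-CriticalPhenomena-blind` toward `PercolationContinuityZ3`.
Setting: a step graph `K` on `V`, a subgraph `K₀ ≤ K` ("no interface edges": in the application
`K = withinGraph ℤ³ (A ∪ B)` and `K₀ = withinGraph ℤ³ A ⊔ withinGraph ℤ³ B`), a configuration `ω`.
The *pieces* are the clusters `openClusterIn K₀ ω v`.  If every piece is finite and `K` is locally
finite, an infinite `K`-cluster of `x` contains, for every `n`, an *exact chain* of `n` open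
interface edges `(uᵢ, vᵢ)`: `u₀` in the piece of `x`, `u_{i+1}` in the piece of `vᵢ`, the pieces at
pairwise distinct "depths" (`depthSet`, `depthLayer`, `exactChain`, `exists_exactChain_of_infinite`).
The probabilistic half (disjoint witnesses, BK) is `SoloBlindChainBK`.
Sources: Grimmett, *Percolation* (2nd ed. 1999), §7.2 (open paths in a region); the layering is the
usual breadth-first decomposition of a cluster into pieces (folklore).
-/

noncomputable section

namespace Summit.CriticalPhenomena.PercolationContinuityZ3.Theorems

open MeasureTheory Literature.Probability.Percolation Literature.Probability.LatticeModels

section Deterministic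

variable {V : Type*} (K₀ K : SimpleGraph V) (ω : BondConfig V) (x : V)

/-- Depth sets: `D 0` is the piece of `x`; `D (n+1)` adds the pieces of all vertices joined to
`D n` by an open edge of `K`. -/
def depthSet : ℕ → Set V
  | 0 => openClusterIn K₀ ω x
  | n + 1 => depthSet n ∪
      ⋃ u ∈ depthSet n, ⋃ (v : V) (_ : K.Adj u v ∧ s(u, v) ∈ ω), openClusterIn K₀ ω v

variable {K₀ K ω x}

/-- Depth `0` is the piece of `x`. -/
theorem depthSet_zero : depthSet K₀ K ω x 0 = openClusterIn K₀ ω x := rfl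

/-- The successor depth set, unfolded. -/
theorem depthSet_succ (n : ℕ) : depthSet K₀ K ω x (n + 1) = depthSet K₀ K ω x n ∪
    ⋃ u ∈ depthSet K₀ K ω x n, ⋃ (v : V) (_ : K.Adj u v ∧ s(u, v) ∈ ω), openClusterIn K₀ ω v :=
  rfl

/-- Depth sets increase. -/
theorem depthSet_subset_succ (n : ℕ) : depthSet K₀ K ω x n ⊆ depthSet K₀ K ω x (n + 1) := by
  rw [depthSet_succ]; exact Set.subset_union_left

/-- Depth sets are monotone in the depth. -/
theorem depthSet_mono : Monotone (depthSet K₀ K ω x) :=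
  monotone_nat_of_le_succ depthSet_subset_succ

/-- The piece of a vertex joined to `D n` by an open `K`-edge lies in `D (n+1)`. -/
theorem piece_subset_depthSet_succ {n : ℕ} {u v : V} (hu : u ∈ depthSet K₀ K ω x n)
    (hK : K.Adj u v) (hω : s(u, v) ∈ ω) :
    openClusterIn K₀ ω v ⊆ depthSet K₀ K ω x (n + 1) := by
  intro z hz
  rw [depthSet_succ]
  refine Or.inr ?_
  simp only [Set.mem_iUnion]
  exact ⟨u, hu, v, ⟨hK, hω⟩, hz⟩

/-- Depth sets are unions of pieces. -/
theorem piece_subset_depthSet {n : ℕ} {u : V} (hu : u ∈ depthSet K₀ K ω x n) :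
    openClusterIn K₀ ω u ⊆ depthSet K₀ K ω x n := by
  induction n generalizing u with
  | zero =>
    rw [depthSet_zero] at hu ⊢
    rw [openClusterIn_eq_of_mem hu]
  | succ n ih =>
    rw [depthSet_succ] at hu
    rcases hu with hu | hu
    · exact (ih hu).trans (depthSet_subset_succ n)
    · simp only [Set.mem_iUnion] at hu
      obtain ⟨u', hu', v, ⟨hK, hω⟩, huv⟩ := hu
      rw [openClusterIn_eq_of_mem huv]
      exact piece_subset_depthSet_succ hu' hK hω

/-- An open `K`-walk starting in `D n` ends in `D (n + length)`. -/
theorem mem_depthSet_of_walk {a b : V} (w : (openGraph ω ⊓ K).Walk a b) {n : ℕ}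
    (ha : a ∈ depthSet K₀ K ω x n) : b ∈ depthSet K₀ K ω x (n + w.length) := by
  induction w generalizing n with
  | nil => simpa using ha
  | @cons a c b hac w ih =>
    have hc : c ∈ depthSet K₀ K ω x (n + 1) := by
      rw [SimpleGraph.inf_adj, openGraph_adj] at hac
      exact piece_subset_depthSet_succ ha hac.2 hac.1.1 (self_mem_openClusterIn K₀ ω c)
    have := ih hc
    simp only [SimpleGraph.Walk.length_cons]
    convert this using 2
    omega

/-- The `K`-cluster of `x` is exhausted by the depth sets. -/
theorem openClusterIn_subset_iUnion_depthSet :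
    openClusterIn K ω x ⊆ ⋃ n, depthSet K₀ K ω x n := by
  intro y hy
  rw [mem_openClusterIn_iff] at hy
  obtain ⟨w⟩ := hy
  have h0 : x ∈ depthSet K₀ K ω x 0 := by rw [depthSet_zero]; exact self_mem_openClusterIn K₀ ω x
  exact Set.mem_iUnion.2 ⟨0 + w.length, mem_depthSet_of_walk w h0⟩

/-- If all pieces are finite and `K` is locally finite then every depth set is finite. -/
theorem depthSet_finite (hfin : ∀ v, (openClusterIn K₀ ω v).Finite)
    (hloc : ∀ u, (K.neighborSet u).Finite) (n : ℕ) : (depthSet K₀ K ω x n).Finite := by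
  induction n with
  | zero => rw [depthSet_zero]; exact hfin x
  | succ n ih =>
    rw [depthSet_succ]
    refine ih.union (ih.biUnion fun u _ => ?_)
    refine ((hloc u).biUnion fun v _ => hfin v).subset ?_
    intro z hz
    simp only [Set.mem_iUnion] at hz ⊢
    obtain ⟨v, ⟨hK, _⟩, hz⟩ := hz
    exact ⟨v, (SimpleGraph.mem_neighborSet K u v).2 hK, hz⟩

/-- The layer of vertices of depth exactly `k`. -/
def depthLayer (K₀ K : SimpleGraph V) (ω : BondConfig V) (x : V) (k : ℕ) : Set V :=
  {a | a ∈ depthSet K₀ K ω x k ∧ ∀ j, j < k → a ∉ depthSet K₀ K ω x j}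

/-- Membership in an exact-depth layer, unfolded. -/
theorem mem_depthLayer_iff {k : ℕ} {a : V} : a ∈ depthLayer K₀ K ω x k ↔
    a ∈ depthSet K₀ K ω x k ∧ ∀ j, j < k → a ∉ depthSet K₀ K ω x j := Iff.rfl

/-- The exact-depth-`0` layer is the piece of `x`. -/
theorem mem_depthLayer_zero : x ∈ depthLayer K₀ K ω x 0 :=
  ⟨by rw [depthSet_zero]; exact self_mem_openClusterIn K₀ ω x, fun j hj => absurd hj (Nat.not_lt_zero j)⟩

/-- Depth is constant on pieces. -/
theorem mem_depthLayer_of_mem_piece {k : ℕ} {a z : V} (ha : a ∈ depthLayer K₀ K ω x k)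
    (hz : z ∈ openClusterIn K₀ ω a) : z ∈ depthLayer K₀ K ω x k := by
  refine ⟨piece_subset_depthSet ha.1 hz, fun j hj hzj => ha.2 j hj ?_⟩
  have := piece_subset_depthSet hzj
  rw [openClusterIn_eq_of_mem hz] at this
  exact this (self_mem_openClusterIn K₀ ω a)

/-- Depth is unique. -/
theorem depthLayer_unique {k j : ℕ} {a : V} (hk : a ∈ depthLayer K₀ K ω x k)
    (hj : a ∈ depthLayer K₀ K ω x j) : k = j := by
  rcases lt_trichotomy k j with h | h | h
  · exact absurd hk.1 (hj.2 k h)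
  · exact h
  · exact absurd hj.1 (hk.2 j h)

/-- Every vertex of some depth set has an exact depth. -/
theorem exists_mem_depthLayer_of_mem {n : ℕ} {y : V} (hy : y ∈ depthSet K₀ K ω x n) :
    ∃ m, m ≤ n ∧ y ∈ depthLayer K₀ K ω x m := by
  classical
  have hex : ∃ m, y ∈ depthSet K₀ K ω x m := ⟨n, hy⟩
  refine ⟨Nat.find hex, Nat.find_min' hex hy, Nat.find_spec hex, fun j hj => Nat.find_min hex hj⟩

/-- The event that `l` is an *exact chain* of open interface edges from the piece of `a` (at depth
`k`) to `y`: `u₀` lies in the piece of `a`, `(uᵢ, vᵢ)` is an open edge of `K`, `vᵢ` has depth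
exactly `k + i + 1`, `u_{i+1}` lies in the piece of `vᵢ`, and `y` lies in the last piece. -/
def exactChain (K₀ K : SimpleGraph V) (x : V) : ℕ → V → List (V × V) → V → Set (BondConfig V)
  | _, a, [], y => {ω | y ∈ openClusterIn K₀ ω a}
  | k, a, e :: l, y => {ω | e.1 ∈ openClusterIn K₀ ω a ∧ (K.Adj e.1 e.2 ∧ s(e.1, e.2) ∈ ω) ∧
      e.2 ∈ depthLayer K₀ K ω x (k + 1) ∧ ω ∈ exactChain K₀ K x (k + 1) e.2 l y}

/-- The empty exact chain: `y` lies in the piece of `a`. -/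
@[simp] theorem mem_exactChain_nil {k : ℕ} {a y : V} :
    ω ∈ exactChain K₀ K x k a [] y ↔ y ∈ openClusterIn K₀ ω a := Iff.rfl

/-- An exact chain with a first interface edge, unfolded. -/
@[simp] theorem mem_exactChain_cons {k : ℕ} {a y : V} {e : V × V} {l : List (V × V)} :
    ω ∈ exactChain K₀ K x k a (e :: l) y ↔ e.1 ∈ openClusterIn K₀ ω a ∧
      (K.Adj e.1 e.2 ∧ s(e.1, e.2) ∈ ω) ∧ e.2 ∈ depthLayer K₀ K ω x (k + 1) ∧
      ω ∈ exactChain K₀ K x (k + 1) e.2 l y := Iff.rfl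

/-- Appending one more open interface edge to an exact chain. -/
theorem exactChain_append {l : List (V × V)} : ∀ {k : ℕ} {a u v y : V},
    ω ∈ exactChain K₀ K x k a l u → (K.Adj u v ∧ s(u, v) ∈ ω) →
    v ∈ depthLayer K₀ K ω x (k + l.length + 1) → y ∈ openClusterIn K₀ ω v →
    ω ∈ exactChain K₀ K x k a (l ++ [(u, v)]) y := by
  induction l with
  | nil =>
    intro k a u v y hc huv hv hy
    rw [mem_exactChain_nil] at hc
    simp only [List.nil_append, mem_exactChain_cons, mem_exactChain_nil]
    exact ⟨hc, huv, by simpa using hv, hy⟩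
  | cons e l ih =>
    intro k a u v y hc huv hv hy
    rw [mem_exactChain_cons] at hc
    obtain ⟨h1, h2, h3, h4⟩ := hc
    rw [List.cons_append, mem_exactChain_cons]
    refine ⟨h1, h2, h3, ih h4 huv ?_ hy⟩
    simp only [List.length_cons] at hv
    convert hv using 2
    omega

/-- **Exact chains exist down to every vertex**: a vertex of exact depth `m` is the end of an
exact chain of `m` open interface edges starting in the piece of `x`. -/
theorem exists_exactChain_of_mem_depthLayer : ∀ (m : ℕ) {y : V}, y ∈ depthLayer K₀ K ω x m →
    ∃ l : List (V × V), l.length = m ∧ ω ∈ exactChain K₀ K x 0 x l y := by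
  intro m
  induction m with
  | zero =>
    intro y hy
    refine ⟨[], rfl, ?_⟩
    rw [mem_exactChain_nil, ← depthSet_zero (K := K)]
    exact hy.1
  | succ m ih =>
    intro y hy
    obtain ⟨hyD, hynot⟩ := hy
    rw [depthSet_succ] at hyD
    have hym : y ∉ depthSet K₀ K ω x m := hynot m (Nat.lt_succ_self m)
    rcases hyD with hyD | hyD
    · exact absurd hyD hym
    simp only [Set.mem_iUnion] at hyD
    obtain ⟨u, hu, v, ⟨hK, hω⟩, hyv⟩ := hyD
    -- `u` has depth exactly `m`
    have huAt : u ∈ depthLayer K₀ K ω x m := by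
      refine ⟨hu, fun j hj huj => ?_⟩
      have h1 : openClusterIn K₀ ω v ⊆ depthSet K₀ K ω x (j + 1) := piece_subset_depthSet_succ huj hK hω
      exact hym (depthSet_mono (by omega) (h1 hyv))
    -- `v` has depth exactly `m + 1`
    have hvAt : v ∈ depthLayer K₀ K ω x (m + 1) := by
      refine ⟨piece_subset_depthSet_succ hu hK hω (self_mem_openClusterIn K₀ ω v), fun j hj hvj => ?_⟩
      have h1 : openClusterIn K₀ ω v ⊆ depthSet K₀ K ω x j := piece_subset_depthSet hvj
      exact hym (depthSet_mono (by omega) (h1 hyv))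
    obtain ⟨l, hl, hc⟩ := ih huAt
    refine ⟨l ++ [(u, v)], by simp [hl], exactChain_append hc ⟨hK, hω⟩ ?_ hyv⟩
    simpa [hl] using hvAt

/-- Prefixes of exact chains are exact chains (to some end vertex). -/
theorem exactChain_take {l : List (V × V)} : ∀ {k : ℕ} {a y : V} (n : ℕ),
    ω ∈ exactChain K₀ K x k a l y → ∃ y', ω ∈ exactChain K₀ K x k a (l.take n) y' := by
  induction l with
  | nil => intro k a y n h; exact ⟨y, by simpa using h⟩
  | cons e l ih =>
    intro k a y n h
    cases n with
    | zero => exact ⟨e.1, by simpa using (mem_exactChain_cons.1 h).1⟩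
    | succ n =>
      obtain ⟨h1, h2, h3, h4⟩ := mem_exactChain_cons.1 h
      obtain ⟨y', hy'⟩ := ih n h4
      exact ⟨y', by rw [List.take_succ_cons, mem_exactChain_cons]; exact ⟨h1, h2, h3, hy'⟩⟩

/-- **Infinite clusters contain exact chains of every length.** If every piece is finite, `K` is
locally finite and the `K`-cluster of `x` is infinite, then for every `n` there is an exact chain
of `n` open interface edges starting in the piece of `x`. -/
theorem exists_exactChain_of_infinite (hfin : ∀ v, (openClusterIn K₀ ω v).Finite)
    (hloc : ∀ u, (K.neighborSet u).Finite) (hinf : (openClusterIn K ω x).Infinite) (n : ℕ) :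
    ∃ (l : List (V × V)) (y : V), l.length = n ∧ ω ∈ exactChain K₀ K x 0 x l y := by
  -- a vertex of the cluster outside the finite set `D n` has exact depth `> n`
  obtain ⟨y, hyC, hyn⟩ : ∃ y, y ∈ openClusterIn K ω x ∧ y ∉ depthSet K₀ K ω x n :=
    Set.Infinite.exists_notMem_finite hinf (depthSet_finite hfin hloc n)
  obtain ⟨N, hN⟩ := Set.mem_iUnion.1 (openClusterIn_subset_iUnion_depthSet (K₀ := K₀) hyC)
  obtain ⟨m, -, hm⟩ := exists_mem_depthLayer_of_mem hN
  have hnm : n ≤ m := by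
    by_contra h
    exact hyn (depthSet_mono (by omega) hm.1)
  obtain ⟨l, hl, hc⟩ := exists_exactChain_of_mem_depthLayer m hm
  obtain ⟨y', hy'⟩ := exactChain_take n hc
  exact ⟨l.take n, y', by simp [hl, hnm], hy'⟩

/-- In an exact chain the interface edges are never edges of `K₀`. -/
theorem not_adj_of_exactChain {l : List (V × V)} : ∀ {k : ℕ} {a y : V},
    a ∈ depthLayer K₀ K ω x k → ω ∈ exactChain K₀ K x k a l y → ∀ e ∈ l, ¬K₀.Adj e.1 e.2 := by
  induction l with
  | nil => intro k a y _ _ e he; simp at he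
  | cons e₀ l ih =>
    intro k a y ha h e he
    obtain ⟨h1, ⟨hK, hω⟩, h3, h4⟩ := mem_exactChain_cons.1 h
    rcases List.mem_cons.1 he with rfl | he
    · intro hadj
      have hv : e.2 ∈ openClusterIn K₀ ω a := mem_openClusterIn_of_adj h1 hadj hω
      have := depthLayer_unique (mem_depthLayer_of_mem_piece ha hv) h3
      omega
    · exact ih h3 h4 e he

/-- In an exact chain consecutive interface edges are not reverse to each other: the far endpoint
of the next edge is two levels deeper than the near endpoint of the previous one. -/
theorem exactChain_isChain_ne {l : List (V × V)} : ∀ {k : ℕ} {a y : V},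
    a ∈ depthLayer K₀ K ω x k → ω ∈ exactChain K₀ K x k a l y → l.IsChain (fun e e' => e'.2 ≠ e.1) := by
  induction l with
  | nil => intro k a y _ _; exact List.isChain_nil
  | cons e₀ l ih =>
    intro k a y ha h
    obtain ⟨h1, _, h3, h4⟩ := mem_exactChain_cons.1 h
    cases l with
    | nil => exact List.isChain_singleton e₀
    | cons e₁ l =>
      refine List.isChain_cons_cons.2 ⟨?_, ih h3 h4⟩
      intro heq
      obtain ⟨_, _, h3', _⟩ := mem_exactChain_cons.1 h4
      have := depthLayer_unique (mem_depthLayer_of_mem_piece ha h1) (heq ▸ h3')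
      omega

/-- The near endpoint of each interface edge of an exact chain lies in the piece of the chain's
current vertex; in particular every near endpoint is `K₀`-connected to a vertex of the previous
level (recorded here in the form used downstream: membership is transported along pieces). -/
theorem exactChain_fst_mem {k : ℕ} {a y : V} {e : V × V} {l : List (V × V)}
    (h : ω ∈ exactChain K₀ K x k a (e :: l) y) : e.1 ∈ openClusterIn K₀ ω a :=
  (mem_exactChain_cons.1 h).1

end Deterministic

end Summit.CriticalPhenomena.PercolationContinuityZ3.Theorems

end
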